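import Summits.NavierStokesRegularity.FunctionalMining.C1WeightIntegral
import Literature.Analysis.FluidPDE.TorusVelocityMomentBalance
import Literature.Analysis.FunctionSpaces.TorusChainRule
import Literature.Analysis.FunctionSpaces.TorusLowOrderLeibniz
import HarnessLib

/-!
# FunctionalMining — the weighted velocity balance `d/dt ∫ Ψ(|u|²)` with a `C¹` weight

Search for candidate a priori estimates; no regularity claim. Cell `pub-nsfunc`, prove seat
(gen 10). The tree's `L^α` energy method (`IsClassicalNSSolutionOn.hasDerivWithinAt_integral_comp_normSq`,
Robinson–Rodrigo–Sadowski 2016 Ex. 11.1–11.4) integrates the viscous and pressure terms by parts and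
therefore asks for a weight `Ψ` of class `C^∞` near the values of `|u|²`. The velocity moments
`U_s = ∫|u|^s = ∫ (|u|²)^{s/2}` of the K0 rows `EV.s|T_LD|G1` with non-integer `s/2` (SIEVELD §3.5:
`s = 9/2`) have the weight `r ↦ r^{s/2}`, only `C¹`/`C²` at `r = 0`. Keeping the viscous and
pressure terms as printed, a `C¹` weight suffices:

`d/dt ∫ Ψ(|u|²) = 2ν ∫ Ψ'(|u|²) ⟪u, Δu⟫ − 2 ∫ Ψ'(|u|²) ⟪u, ∇p⟫ + 2 ∫ Ψ'(|u|²) ⟪u, f⟫`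

(one-sided within `[a, b]`; the transport term `∫ Ψ'(|u|²)⟪(u·∇)u, u⟫ = ½∫ div(Ψ(|u|²) u) = 0`
by the `C¹` divergence theorem; differentiation under the integral by
`C1Weight.hasDerivWithinAt_integral_comp_of_contDiffOn_one`).

## Main statements

* `VelocityMoment.integral_deriv_comp_normSq_mul_inner_convect_eq_zero_of_contDiffOn_one` — the
  transport term vanishes for a `C¹` weight.
* `VelocityMoment.hasDerivWithinAt_integral_comp_normSq_of_contDiffOn_one` — the balance.
-/

noncomputable section

open MeasureTheory Finset Set Filter Topology
open scoped InnerProductSpace RealInnerProductSpace ContDiff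

namespace Summit.NavierStokesRegularity.FunctionalMining

open Literature.Analysis.FunctionSpaces Literature.Analysis.FluidPDE

namespace VelocityMoment

variable {d : Type*} [Fintype d] [DecidableEq d]

/-- `∂ₖ|v|² = 2⟪v, ∂ₖv⟫` for `C¹` fields. [folklore] -/
theorem partialDeriv_normSq' {v : UnitAddTorus d → EuclideanSpace ℝ d}
    (hv : Torus.IsContDiff 1 v) (k : d) (x : UnitAddTorus d) :
    Torus.partialDeriv k (fun y => ‖v y‖ ^ 2) x = 2 * ⟪v x, Torus.partialDeriv k v x⟫ := by
  have hsq : (fun y => ‖v y‖ ^ 2) = fun y => ⟪v y, v y⟫ :=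
    funext fun y => (real_inner_self_eq_norm_sq _).symm
  rw [hsq, Torus.partialDeriv_inner hv hv, real_inner_comm (Torus.partialDeriv k v x) (v x)]
  ring

/-- **Transport term with a `C¹` weight** (Robinson–Rodrigo–Sadowski 2016, Exercise 11.3 for a
general weight): for smooth divergence-free `v` and `g` of class `C¹` on an open set containing the
values of `|v|²`, `∫ g'(|v|²) ⟪(v·∇)v, v⟫ = ½ ∫ div(g(|v|²) v) = 0`.
[cite: RobinsonRodrigoSadowski2016, Ch. 11 Exercise 11.3] -/
theorem integral_deriv_comp_normSq_mul_inner_convect_eq_zero_of_contDiffOn_one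
    {v : UnitAddTorus d → EuclideanSpace ℝ d} (hv : Torus.IsSmooth v) (hdiv : Torus.IsDivFree v)
    {g : ℝ → ℝ} {U : Set ℝ} (hU : IsOpen U) (hg : ContDiffOn ℝ 1 g U)
    (hmaps : ∀ x, ‖v x‖ ^ 2 ∈ U) :
    ∫ x, deriv g (‖v x‖ ^ 2) * ⟪Torus.convect v v x, v x⟫ = 0 := by
  have hQ : Torus.IsSmooth (fun y => ‖v y‖ ^ 2) := hv.norm_sq
  have hQ1 : Torus.IsContDiff 1 (fun y => ‖v y‖ ^ 2) := hQ.isContDiff (by simp)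
  have hv1 : Torus.IsContDiff 1 v := hv.isContDiff (by simp)
  have hθ : Torus.IsContDiff 1 (fun y => g (‖v y‖ ^ 2)) := by
    unfold Torus.IsContDiff at hQ1 ⊢
    exact hg.comp_contDiff hQ1 fun z => hmaps _
  have hθv : Torus.IsContDiff 1 (fun y => g (‖v y‖ ^ 2) • v y) := by
    unfold Torus.IsContDiff at hθ hv1 ⊢
    exact hθ.smul hv1
  have hpt : ∀ x, deriv g (‖v x‖ ^ 2) * ⟪Torus.convect v v x, v x⟫ =
      2⁻¹ * Torus.divergence (fun y => g (‖v y‖ ^ 2) • v y) x := by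
    intro x
    have hgd : DifferentiableAt ℝ g (‖v x‖ ^ 2) :=
      (hg.differentiableOn (by simp)).differentiableAt (hU.mem_nhds (hmaps x))
    rw [Torus.divergence_smul hθ hv1 x, hdiv x, mul_zero, zero_add, Torus.convect,
      Torus.fderiv_apply_eq_sum_partialDeriv hv1, sum_inner, Finset.mul_sum, Finset.mul_sum]
    refine Finset.sum_congr rfl fun k _ => ?_
    rw [Torus.partialDeriv_comp_of_differentiableAt hgd hQ1 k, partialDeriv_normSq' hv1 k x,
      real_inner_smul_left, real_inner_comm]
    ring
  simp_rw [hpt]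
  rw [integral_const_mul, Torus.integral_divergence_eq_zero_of_isContDiff hθv, mul_zero]

/-- **The weighted velocity balance with a `C¹` weight along classical Navier–Stokes solutions on
`T^d`.** Let `(u, p)` be a classical solution of `∂ₜu + (u·∇)u = νΔu − ∇p + f`, `div u = 0` on
`T^d × [a, b]` (`a < b`) and `Ψ` be of class `C¹` on an open `U ⊆ ℝ` containing every `|u(s, x)|²`,
`s ∈ [a, b]`. Then `s ↦ ∫ Ψ(|u(s)|²)` has, at every `t ∈ [a, b]`, the one-sided derivative
`2ν ∫ Ψ'(|u|²) ⟪u, Δu⟫ − 2 ∫ Ψ'(|u|²) ⟪u, ∇p⟫ + 2 ∫ Ψ'(|u|²) ⟪u, f⟫` within `[a, b]` (pair the momentum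
equation with `2Ψ'(|u|²)u`; the transport term vanishes; viscous and pressure terms as printed —
the `C^∞`-weight version `hasDerivWithinAt_integral_comp_normSq` integrates them by parts).
[cite: RobinsonRodrigoSadowski2016, Ch. 11 Exercise 11.4 eq. (11.19)] -/
theorem hasDerivWithinAt_integral_comp_normSq_of_contDiffOn_one
    {a b ν : ℝ} {f u : ℝ → UnitAddTorus d → EuclideanSpace ℝ d} {p : ℝ → UnitAddTorus d → ℝ}
    (h : Torus.IsClassicalNSSolutionOn (Icc a b) ν f u p) (hab : a < b) {Ψ : ℝ → ℝ} {U : Set ℝ}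
    (hUo : IsOpen U) (hΨ : ContDiffOn ℝ 1 Ψ U)
    (hmaps : ∀ s ∈ Icc a b, ∀ x, ‖u s x‖ ^ 2 ∈ U) {t : ℝ} (ht : t ∈ Icc a b) :
    HasDerivWithinAt (fun s => ∫ x, Ψ (‖u s x‖ ^ 2))
      (2 * ν * (∫ x, deriv Ψ (‖u t x‖ ^ 2) * ⟪u t x, Torus.laplacian (u t) x⟫) -
        2 * (∫ x, deriv Ψ (‖u t x‖ ^ 2) * ⟪u t x, Torus.gradient (p t) x⟫) +
        2 * ∫ x, deriv Ψ (‖u t x‖ ^ 2) * ⟪u t x, f t x⟫)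
      (Icc a b) t := by
  have hU : UniqueDiffOn ℝ (Icc a b) := uniqueDiffOn_Icc hab
  have hu : Torus.IsSmoothSpaceTimeOn (Icc a b) u := h.smooth_velocity
  have hut : Torus.IsSmooth (u t) := hu.isSmooth_slice ht
  have hdivt : Torus.IsDivFree (u t) := h.divFree t ht
  have hpt' : Torus.IsSmooth (p t) := h.smooth_pressure.isSmooth_slice ht
  have hQ : Torus.IsSmooth (fun y => ‖u t y‖ ^ 2) := hut.norm_sq
  have hΨ'c : ContinuousOn (deriv Ψ) U := hΨ.continuousOn_deriv_of_isOpen hUo le_rfl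
  have hGc : Continuous (fun y => deriv Ψ (‖u t y‖ ^ 2)) :=
    hΨ'c.comp_continuous hQ.continuous (hmaps t ht)
  have hA : Torus.IsSmooth (Torus.timeDerivWithin (Icc a b) u t) := hu.isSmooth_timeDerivWithin hU ht
  -- the forcing slice is smooth (momentum equation)
  have hf : Torus.IsSmooth (f t) := by
    have hfun : f t = fun y => Torus.timeDerivWithin (Icc a b) u t y + Torus.convect (u t) (u t) y -
        ν • Torus.laplacian (u t) y + Torus.gradient (p t) y := by
      funext y
      have := h.momentum t ht y
      rw [this]
      abel
    rw [hfun]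
    exact ((hA.add (hut.convect hut)).sub (hut.laplacian.smul ν)).add hpt'.gradient
  -- Step 1: differentiate under the integral sign (`C¹` outer function)
  have hQst : Torus.IsSmoothSpaceTimeOn (Icc a b) (fun s y => ‖u s y‖ ^ 2) := hu.norm_sq ℝ
  have hD := C1Weight.hasDerivWithinAt_integral_comp_of_contDiffOn_one hab hQst hUo hΨ hmaps ht
  refine hD.congr_deriv ?_
  -- Step 2: the time derivative of `|u|²` and the momentum equation, pointwise
  have hslice : ∀ x, Torus.timeDerivWithin (Icc a b) (fun s y => ‖u s y‖ ^ 2) t x =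
      2 * ⟪u t x, Torus.timeDerivWithin (Icc a b) u t x⟫ := by
    intro x
    have h1 := (hu.hasDerivWithinAt_slice ht x).norm_sq
    rw [Torus.timeDerivWithin]
    exact h1.derivWithin (hU t ht)
  have hmom : ∀ x, Torus.timeDerivWithin (Icc a b) u t x = ν • Torus.laplacian (u t) x -
      Torus.gradient (p t) x + f t x - Torus.convect (u t) (u t) x := by
    intro x
    rw [← h.momentum t ht x]
    abel
  set G1 : UnitAddTorus d → ℝ := fun y => deriv Ψ (‖u t y‖ ^ 2) with hG1def
  have e1 : ∀ x, deriv Ψ (‖u t x‖ ^ 2) * Torus.timeDerivWithin (Icc a b) (fun s y => ‖u s y‖ ^ 2) t x =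
      2 * ν * (G1 x * ⟪u t x, Torus.laplacian (u t) x⟫) -
        2 * (G1 x * ⟪u t x, Torus.gradient (p t) x⟫) +
        2 * (G1 x * ⟪u t x, f t x⟫) - 2 * (G1 x * ⟪Torus.convect (u t) (u t) x, u t x⟫) := by
    intro x
    rw [hslice x, hmom x, hG1def]
    simp only [inner_sub_right, inner_add_right, real_inner_smul_right,
      real_inner_comm (Torus.convect (u t) (u t) x) (u t x)]
    ring
  show ∫ x, deriv Ψ (‖u t x‖ ^ 2) * Torus.timeDerivWithin (Icc a b) (fun s y => ‖u s y‖ ^ 2) t x = _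
  simp_rw [e1]
  -- Step 3: split the integral; the transport term vanishes
  have hG1c : Continuous G1 := by rw [hG1def]; exact hGc
  have cL : Continuous (fun x => G1 x * ⟪u t x, Torus.laplacian (u t) x⟫) :=
    hG1c.mul (hut.inner hut.laplacian).continuous
  have cP : Continuous (fun x => G1 x * ⟪u t x, Torus.gradient (p t) x⟫) :=
    hG1c.mul (hut.inner hpt'.gradient).continuous
  have cF : Continuous (fun x => G1 x * ⟪u t x, f t x⟫) := hG1c.mul (hut.inner hf).continuous
  have cC : Continuous (fun x => G1 x * ⟪Torus.convect (u t) (u t) x, u t x⟫) :=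
    hG1c.mul ((hut.convect hut).inner hut).continuous
  have iL : Integrable (fun x => 2 * ν * (G1 x * ⟪u t x, Torus.laplacian (u t) x⟫)) :=
    cL.integrable_unitAddTorus.const_mul _
  have iP : Integrable (fun x => 2 * (G1 x * ⟪u t x, Torus.gradient (p t) x⟫)) :=
    cP.integrable_unitAddTorus.const_mul _
  have iF : Integrable (fun x => 2 * (G1 x * ⟪u t x, f t x⟫)) :=
    cF.integrable_unitAddTorus.const_mul _
  have iC : Integrable (fun x => 2 * (G1 x * ⟪Torus.convect (u t) (u t) x, u t x⟫)) :=
    cC.integrable_unitAddTorus.const_mul _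
  have iLP : Integrable (fun x => 2 * ν * (G1 x * ⟪u t x, Torus.laplacian (u t) x⟫) -
      2 * (G1 x * ⟪u t x, Torus.gradient (p t) x⟫)) := iL.sub iP
  have iLPF : Integrable (fun x => 2 * ν * (G1 x * ⟪u t x, Torus.laplacian (u t) x⟫) -
      2 * (G1 x * ⟪u t x, Torus.gradient (p t) x⟫) + 2 * (G1 x * ⟪u t x, f t x⟫)) := iLP.add iF
  rw [integral_sub iLPF iC, integral_add iLP iF, integral_sub iL iP, integral_const_mul,
    integral_const_mul, integral_const_mul, integral_const_mul,
    integral_deriv_comp_normSq_mul_inner_convect_eq_zero_of_contDiffOn_one hut hdivt hUo hΨ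
      (hmaps t ht)]
  ring

end VelocityMoment

end Summit.NavierStokesRegularity.FunctionalMining
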